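import Mathlib
import HarnessLib
import Summits.HubbardSuperconductivity.HubbardSuperconductivity.Theorems.KLProgrammeKLRegimeEngineNormsJumpResectorisation
import Summits.HubbardSuperconductivity.HubbardSuperconductivity.Theorems.KLProgrammeH10TwoPointLimitSectorMultiplierJumpRegime
import Summits.HubbardSuperconductivity.HubbardSuperconductivity.Theorems.KLProgrammeKLRegimeEngineThinCount6Doors
import Summits.HubbardSuperconductivity.HubbardSuperconductivity.Theorems.KLProgrammeKLRegimeWickCrossContractionSupport

/-!
# K3 ENGINE child `KLRegimeEngineV17F2` (stmt-HubbardSuperconductivity-20437), stub (b) closing path: the SIX-LEG IMPORT BY JUMP RE-SECTORISATION —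
# a block input's sectorised six-leg norm at a FINER level `J′` from its sectorised six-leg norm at a COARSER level `k`, LOSSLESS against the
# degree-6 law `CE³·ε_j²·2^{4j}` (cure (C2) of the located finding «(ℓ)/(b)-6LEG-PLAIN-CURRENCY», KL STATUS 2026-08-29 10:04Z)

Cell gate-hubbard-kl, seat hubbard-kl-k3c2-p3 (g17), row «sector-counting import».  WHY.  The six-leg E1 rows of the (b)/(ℓ) closing path read PLAIN
(`trivialMultiplier`) pinned lines of the six-leg kernel of a block input `𝒱_{dk}[K]` and multiply them by the label count `klThinCount6C·|SectorLeg(Ō_j)|⁴`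
(`…ThinCount6Doors`, `…TowerImportXFloorPlain`, `…TowerReadoutSixCellPlain`, the W-assembly's cells); but the plain six-leg line carries the one-particle-reducible
bridge `C^K_{>Λ}` (`≥ c₆·U²·4^j/(2·klE0)` at second order), so those rows are unfeedable at deep levels (memo `SIX-LEG-PLAIN-LINE-CURRENCY.md`, evidence #60 on
20437).  The SECTORISED six-leg currency (BGM 2006 (2.77) `J^{(1)}` at `|P_{v₀}| = 6`: `γ^{−2h} = 2^{4j}`) has no such defect, and — unlike four legs, where
refining sectors costs `2^{2Δ}` against a law ratio `2^{Δ}` (P2-IMPORT F1) — at six legs the RELATIVE sector count of a jump `k → J′` is `≍ 2^{4(J′−k)}`,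
EXACTLY the ratio of the degree-6 laws: re-sectorisation is budget-neutral.  This file composes the lineage's jump lemma (g5, p538531), the regime's
uniform jump overlap constants (g6, `overlap_jump_sums_klEng`) and the five-anchored six-leg count (g14 doors) into that import:

* §1 `card_filter_le_of_fiveAnchored_of_mem` — combinatorics: a one-anchor count of six-leg label tuples whose free legs are confined to sets of size `≤ B`
  is `≤ C·B⁴` when every five-anchored count is `≤ C` (four legs summed inside their confinement sets, the sixth by the five-anchor bound);
* §2 `card_overlapLeg_le`, **`relCount_six_jump_le_doors`** — the relative count `R` of `EngineV8.hubbardSectorKernelNorm_klAniso_jump_le_of_relCount` at six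
  legs: under the five-anchored doors (`0 ≤ R.Gfr`, `c ≤ klThinCount6C₃ R`, `U ≤ klThinCount6U₀ R`, regime, `FrameOK`), for every coarse label tuple `σ′`
  of `bgmFatMultiplier k`, pinned leg and fine label, the number of fine (`klAnisoFamily J′`, `k ≤ J′`) conservation-compatible 6-tuples through the pin that
  overlap `σ′` leg by leg is `≤ klThinCount6C·(27·2^{J′−k})⁴` (`card_overlap_klAniso_bgmFat_fine_le`: `≤ 27·2^{J′−k}` fine sectors per fat coarse sector);
* §3 **`sixLeg_sectorNorm_jump_le_klEng`** — `∃ C₆ > 0`: under EXACTLY the binders of `stub_engine_step_norms` used by `overlap_jump_sums_klEng` (`P.WF`, `R.WF2`,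
  `0 < c ≤ klEngC₃6 P R`, `μ ∈ klWindowC`, `0 < U ≤ klEngU₀9 P R c`, `klBetaMin ≤ β ≤ e^{c/U²}`, `FrameOK R U (nScales β) μ K`, `klEngL₃ β U ≤ L`, `klEngM₃ β U L ≤ M`)
  plus the six-count doors, for EVERY Grassmann polynomial `G` and every jump `k + 1 ≤ J′ ≤ nScales β + 1`:
  `‖G‖_{klAnisoFamily J′, bgmSectorSet, 6} ≤ C₆·16^{J′−k}·‖G‖_{klAnisoFamily k, univ, 6}` — `C₆ = (19683/64)·27⁴·C_J⁶·klThinCount6C`, n-, jump-, β-, L-, M-,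
  frame-UNIFORM;
* §4 KL vocabulary: `hubbardSectorKernelNorm_univ_eq_bgmSectorSet_of_conserving` (for a momentum-conserving `G` the `univ` norm IS the constrained one),
  **`klLevNormOf_six_jump_le_klEng`** (every fine prescription `Ωe″`: `klLevNormOf … J′ 6 G Ωe″ ≤ C₆·16^{J′−k}·klLevNormOf … k 6 G (fun _ => none)` for conserving `G`),
  the instance **`klLevNormOf_six_klTowerInput_jump_le_klEng`** (`G = klTowerInput … d k′ = 𝒱_{dk′}[K]`), and the LAW TRANSPORT `degreeSixLaw_mono_jump`
  (`CE³·ε_k²·2^{4k}·16^{J′−k} ≤ CE³·ε_{J′}²·2^{4J′}`) with the headline **`klLevNormOf_six_klTowerInput_le_law_of_coarse_law`**: if the block input meets the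
  degree-6 law at level `k` (unprescribed row) then it meets `C₆ ×` the degree-6 law at every finer level `J′ ≤ nScales β + 1` (every prescription, no gain claimed).
So the six-leg IMPORT rows need no plain line: they follow from the six-leg CELL (sectorised clause) at ONE level.  Gains for prescribed fine legs (the `p = 3`
rows with `levelGainExp ≥ 1`) are not claimed here (they need the prescribed jump lemma p548884; the count then frees `4 − (F−1)` legs).  Proofs only; nothing
about the model is asserted beyond these implications; nothing asserts (b), any stub, K3 or superconductivity.
References: BGM 2006 §2.7 (2.71a), §2.8 (2.76)–(2.83), (2.96)–(2.98), Lemma 2.5, App. A3 [cite: BenfattoGiulianiMastropietro2006].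
-/

noncomputable section

/-! ## §1 One anchor + confined free legs from five anchors -/

namespace Summit.HubbardSuperconductivity.HubbardSuperconductivity.Theorems.KLRegimeSplit

set_option linter.dupNamespace false -- summit = problem name (single-conjunct summit), D-0017

open Finset

/-- **One anchor with confined free legs from five anchors**: if every five-anchored count of a set `A` of six-leg label tuples over an alphabet `S` is `≤ C`,
then for every pinned leg `p`, label `s` and confinement sets `O i` of size `≤ B` the number of `Ω ∈ A` with `Ω p = s` and `Ω i ∈ O i` for all `i` is `≤ C·B⁴` —
four further legs summed inside their confinement sets, the sixth counted by the five-anchor bound. [folklore] -/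
theorem card_filter_le_of_fiveAnchored_of_mem {S : Type*} [Fintype S] [DecidableEq S] (A : Finset (Fin 6 → S)) {C B : ℝ} (hC : 0 ≤ C) (hB : 0 ≤ B)
    (h5 : ∀ (E : Finset (Fin 6)), 5 ≤ E.card → ∀ τ : Fin 6 → S, (((A.filter (fun Ω : Fin 6 → S => ∀ e ∈ E, Ω e = τ e)).card : ℕ) : ℝ) ≤ C)
    (p : Fin 6) (s : S) (O : Fin 6 → Finset S) (hO : ∀ i, ((O i).card : ℝ) ≤ B) :
    (((A.filter (fun Ω : Fin 6 → S => Ω p = s ∧ ∀ i, Ω i ∈ O i)).card : ℕ) : ℝ) ≤ C * B ^ 4 := by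
  classical
  set σ : Equiv.Perm (Fin 6) := Equiv.swap 0 p with hσ
  have hσ0 : σ 0 = p := by rw [hσ]; exact Equiv.swap_apply_left 0 p
  set T := A.filter (fun Ω : Fin 6 → S => Ω p = s ∧ ∀ i, Ω i ∈ O i) with hT
  set g : (Fin 6 → S) → S × S × S × S := fun Ω => (Ω (σ 1), Ω (σ 2), Ω (σ 3), Ω (σ 4)) with hg
  set t : Finset (S × S × S × S) := (O (σ 1)) ×ˢ ((O (σ 2)) ×ˢ ((O (σ 3)) ×ˢ (O (σ 4)))) with ht
  -- the anchored legs `σ 0, …, σ 4`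
  set E : Finset (Fin 6) := (Finset.univ : Finset (Fin 5)).image (fun i => σ (Fin.castSucc i)) with hE
  have hinj : Function.Injective (fun i : Fin 5 => σ (Fin.castSucc i)) := fun a b h => Fin.castSucc_injective 5 (σ.injective h)
  have hEcard : 5 ≤ E.card := by
    rw [hE, Finset.card_image_of_injective _ hinj]
    simp
  -- `g` maps `T` into the product of the confinement sets
  have hmaps : ∀ Ω ∈ T, g Ω ∈ t := by
    intro Ω hΩ
    rw [hT, Finset.mem_filter] at hΩ
    simp only [ht, hg, Finset.mem_product]
    exact ⟨hΩ.2.2 _, hΩ.2.2 _, hΩ.2.2 _, hΩ.2.2 _⟩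
  -- each fibre of `g` on `T` is a five-anchored set
  have hfib : ∀ b : S × S × S × S, (((T.filter (fun Ω => g Ω = b)).card : ℕ) : ℝ) ≤ C := by
    intro b
    set vec : Fin 6 → S := ![s, b.1, b.2.1, b.2.2.1, b.2.2.2, s] with hvec
    refine le_trans ?_ (h5 E hEcard (fun e => vec (σ.symm e)))
    exact_mod_cast Finset.card_le_card fun Ω hΩ => by
      rw [Finset.mem_filter] at hΩ
      obtain ⟨hΩT, hgb⟩ := hΩ
      rw [hT, Finset.mem_filter] at hΩT
      refine Finset.mem_filter.2 ⟨hΩT.1, fun e he => ?_⟩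
      rw [hE, Finset.mem_image] at he
      obtain ⟨i, -, rfl⟩ := he
      rw [Equiv.symm_apply_apply]
      subst hgb
      match i with
      | 0 => simpa [hvec, hσ0] using hΩT.2.1
      | 1 => simp [hvec, hg]
      | 2 => simp [hvec, hg]
      | 3 => simp [hvec, hg]
      | 4 => simp [hvec, hg]
  have hsum := Finset.card_eq_sum_card_fiberwise (f := g) (s := T) (t := t) hmaps
  have htcard : ((t.card : ℕ) : ℝ) ≤ B ^ 4 := by
    rw [ht, Finset.card_product, Finset.card_product, Finset.card_product]
    push_cast
    have h1 := hO (σ 1); have h2 := hO (σ 2); have h3 := hO (σ 3); have h4 := hO (σ 4)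
    have h0 : (0 : ℝ) ≤ (O (σ 1)).card := Nat.cast_nonneg _
    have h0' : (0 : ℝ) ≤ (O (σ 2)).card := Nat.cast_nonneg _
    have h0'' : (0 : ℝ) ≤ (O (σ 3)).card := Nat.cast_nonneg _
    have h0''' : (0 : ℝ) ≤ (O (σ 4)).card := Nat.cast_nonneg _
    calc ((O (σ 1)).card : ℝ) * (((O (σ 2)).card : ℝ) * (((O (σ 3)).card : ℝ) * ((O (σ 4)).card : ℝ)))
        ≤ B * (B * (B * B)) := by gcongr
      _ = B ^ 4 := by ring
  calc ((T.card : ℕ) : ℝ) = ∑ b ∈ t, (((T.filter (fun Ω => g Ω = b)).card : ℕ) : ℝ) := by rw [hsum]; push_cast; rfl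
    _ ≤ ∑ _b ∈ t, C := Finset.sum_le_sum fun b _ => hfib b
    _ = (t.card : ℝ) * C := by rw [Finset.sum_const, nsmul_eq_mul]
    _ ≤ B ^ 4 * C := mul_le_mul_of_nonneg_right htcard hC
    _ = C * B ^ 4 := by ring

end Summit.HubbardSuperconductivity.HubbardSuperconductivity.Theorems.KLRegimeSplit

/-! ## §2 The relative count of a jump at six legs -/

namespace Summit.HubbardSuperconductivity.HubbardSuperconductivity.Theorems.EngineV8

set_option linter.dupNamespace false -- summit = problem name (single-conjunct summit), D-0017

open Classical
open Real Finset Literature.MathematicalPhysics.QuantumLattice Literature.Probability.LatticeModels GrassmannAlgebra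
open Summit.HubbardSuperconductivity.HubbardSuperconductivity.Theorems.KLProgrammeLegKernels
open Summit.HubbardSuperconductivity.HubbardSuperconductivity.Theorems.KLRegimeSplit
open Summit.HubbardSuperconductivity.HubbardSuperconductivity.Theorems.TorusFourierL2
open Summit.HubbardSuperconductivity.HubbardSuperconductivity.Theorems.DispersionFlow
open Summit.HubbardSuperconductivity.HubbardSuperconductivity.Theorems.KLRegimeWick

variable {L M : ℕ} [NeZero L]

/-- **The fine LABELS overlapping one fat coarse label**: for `k ≤ J′` and a coarse label `σ′ᵢ = ((ω′, s), c)`, the fine labels `((ω″, s), c)` whose thin sector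
`klAnisoFamily … J′ ω″` meets the fat sector `bgmFatMultiplier … k ω′` are at most `27·2^{J′−k}` (`card_overlap_klAniso_bgmFat_fine_le`, spin and charge fixed).
[cite: BenfattoGiulianiMastropietro2006, §2.7 (2.71a)] -/
theorem card_overlapLeg_le (β μ : ℝ) (K : TrigPolyC4v) {k J' : ℕ} (hkJ : k ≤ J') (ℓ' : SectorLeg (sectorCount k)) :
    ((((univ : Finset (SectorLeg (sectorCount J'))).filter (fun ℓ : SectorLeg (sectorCount J') =>
        (∃ q : FreqMomentum L M, klAnisoFamily L M β μ K klE0 J' ℓ.1.1 q ≠ 0 ∧ bgmFatMultiplier L M klE0 β (nambuXiCT L μ K) k ℓ'.1.1 q ≠ 0) ∧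
          ℓ'.1.2 = ℓ.1.2 ∧ ℓ'.2 = ℓ.2)).card : ℕ) : ℝ) ≤ 27 * (2 : ℝ) ^ (J' - k) := by
  have he : (0 : ℝ) < klE0 := by norm_num [klE0]
  set Tω := (univ : Finset (Fin (sectorCount J'))).filter (fun ω₁ : Fin (sectorCount J') =>
      ∃ q : FreqMomentum L M, klAnisoFamily L M β μ K klE0 J' ω₁ q ≠ 0 ∧
        bgmFatMultiplier L M klE0 β (nambuXiCT L μ K) k ℓ'.1.1 q ≠ 0) with hTω
  have hTω_card : Tω.card ≤ 27 * 2 ^ (J' - k) := card_overlap_klAniso_bgmFat_fine_le he β μ K hkJ ℓ'.1.1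
  have hsub : (univ : Finset (SectorLeg (sectorCount J'))).filter (fun ℓ : SectorLeg (sectorCount J') =>
        (∃ q : FreqMomentum L M, klAnisoFamily L M β μ K klE0 J' ℓ.1.1 q ≠ 0 ∧ bgmFatMultiplier L M klE0 β (nambuXiCT L μ K) k ℓ'.1.1 q ≠ 0) ∧
          ℓ'.1.2 = ℓ.1.2 ∧ ℓ'.2 = ℓ.2) ⊆
      Tω.image (fun ω => ((ω, ℓ'.1.2), ℓ'.2)) := by
    rintro ⟨⟨ω, s⟩, c⟩ hℓ
    rw [mem_filter] at hℓ
    obtain ⟨-, hq, hs, hc⟩ := hℓ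
    rw [mem_image]
    refine ⟨ω, ?_, ?_⟩
    · rw [hTω, mem_filter]; exact ⟨mem_univ _, hq⟩
    · simp only at hs hc; rw [hs, hc]
  calc _ ≤ (((Tω.image (fun ω => ((ω, ℓ'.1.2), ℓ'.2))).card : ℕ) : ℝ) := by exact_mod_cast card_le_card hsub
    _ ≤ ((Tω.card : ℕ) : ℝ) := by exact_mod_cast card_image_le
    _ ≤ ((27 * 2 ^ (J' - k) : ℕ) : ℝ) := by exact_mod_cast hTω_card
    _ = 27 * (2 : ℝ) ^ (J' - k) := by push_cast; ring

/-- **THE RELATIVE COUNT OF A JUMP AT SIX LEGS, UNDER THE FIVE-ANCHORED DOORS**: for `R` with `0 ≤ R.Gfr j`, `0 < c ≤ klThinCount6C₃ R`, `0 < U ≤ klThinCount6U₀ R`,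
`klBetaMin ≤ β ≤ e^{c/U²}`, `μ ∈ klWindowC`, a frame with `FrameOK R U (nScales β) ν K`, scales `k ≤ J′`, every coarse label tuple `σ′`, pinned leg `p` and fine
label `ℓ″`: the fine conservation-compatible 6-tuples `σ″ ∈ bgmSectorSet … (klAnisoFamily … J′) 6` with `σ″ p = ℓ″` whose every leg overlaps `σ′` (support overlap of
the thin fine sector with the fat coarse sector, same spin and charge) number `≤ klThinCount6C·(27·2^{J′−k})⁴` — the `hR` binder of
`hubbardSectorKernelNorm_klAniso_jump_le_of_relCount` at `m + 1 = 6`. [cite: BenfattoGiulianiMastropietro2006, §2.8 (2.82)-(2.83), (2.96)-(2.98), App. A3] -/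
theorem relCount_six_jump_le_doors {R : RenConsts} (hR : ∀ j, 0 ≤ R.Gfr j) {c : ℝ} (hc : 0 < c) (hc₃ : c ≤ klThinCount6C₃ R) {U : ℝ} (hU : 0 < U)
    (hU₀ : U ≤ klThinCount6U₀ R) {β : ℝ} (hβ : klBetaMin ≤ β) (hβc : β ≤ Real.exp (c / U ^ 2)) {μ : ℝ} (hμ : μ ∈ klWindowC) (ν : ℝ) {K : TrigPolyC4v}
    (hK : FrameOK R U (nScales β) ν K) (L M : ℕ) [NeZero L] {k J' : ℕ} (hkJ : k ≤ J')
    (σ' : Fin 6 → SectorLeg (sectorCount k)) (p : Fin 6) (ℓ'' : SectorLeg (sectorCount J')) :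
    ((((bgmSectorSet L M (klAnisoFamily L M β μ K klE0 J') 6).filter fun σ'' : Fin 6 → SectorLeg (sectorCount J') => σ'' p = ℓ'' ∧ ∀ i,
        (∃ q : FreqMomentum L M, klAnisoFamily L M β μ K klE0 J' (σ'' i).1.1 q ≠ 0 ∧
          bgmFatMultiplier L M klE0 β (nambuXiCT L μ K) k (σ' i).1.1 q ≠ 0) ∧
        (σ' i).1.2 = (σ'' i).1.2 ∧ (σ' i).2 = (σ'' i).2).card : ℝ)) ≤ klThinCount6C * (27 * (2 : ℝ) ^ (J' - k)) ^ 4 := by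
  classical
  -- the five-anchored bound for the fine constraint set
  have h3 : klThinCount6C₃ R = Classical.choose (klThinCount6C_spec R hR) := by unfold klThinCount6C₃; exact dif_pos hR
  have hU' : klThinCount6U₀ R = Classical.choose (Classical.choose_spec (klThinCount6C_spec R hR)).2 := by
    unfold klThinCount6U₀; exact dif_pos hR
  have hspec := (Classical.choose_spec (Classical.choose_spec (klThinCount6C_spec R hR)).2).2
  rw [h3] at hc₃
  rw [hU'] at hU₀
  have h5 : ∀ (E : Finset (Fin 6)), 5 ≤ E.card → ∀ τ : Fin 6 → SectorLeg (sectorCount J'),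
      ((((bgmSectorSet L M (klAnisoFamily L M β μ K klE0 J') 6).filter
        (fun Ω : Fin 6 → SectorLeg (sectorCount J') => ∀ e ∈ E, Ω e = τ e)).card : ℕ) : ℝ) ≤ klThinCount6C :=
    fun E hE τ => hspec c hc hc₃ U hU hU₀ β hβ hβc μ hμ ν K hK L M J' E hE τ
  -- the confinement sets
  set O : Fin 6 → Finset (SectorLeg (sectorCount J')) := fun i => (univ : Finset (SectorLeg (sectorCount J'))).filter
    (fun ℓ : SectorLeg (sectorCount J') =>
      (∃ q : FreqMomentum L M, klAnisoFamily L M β μ K klE0 J' ℓ.1.1 q ≠ 0 ∧ bgmFatMultiplier L M klE0 β (nambuXiCT L μ K) k (σ' i).1.1 q ≠ 0) ∧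
        (σ' i).1.2 = ℓ.1.2 ∧ (σ' i).2 = ℓ.2) with hO
  have hOcard : ∀ i, ((O i).card : ℝ) ≤ 27 * (2 : ℝ) ^ (J' - k) := fun i => card_overlapLeg_le β μ K hkJ (σ' i)
  have hcongr : (bgmSectorSet L M (klAnisoFamily L M β μ K klE0 J') 6).filter (fun σ'' : Fin 6 → SectorLeg (sectorCount J') => σ'' p = ℓ'' ∧ ∀ i,
        (∃ q : FreqMomentum L M, klAnisoFamily L M β μ K klE0 J' (σ'' i).1.1 q ≠ 0 ∧
          bgmFatMultiplier L M klE0 β (nambuXiCT L μ K) k (σ' i).1.1 q ≠ 0) ∧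
        (σ' i).1.2 = (σ'' i).1.2 ∧ (σ' i).2 = (σ'' i).2) =
      (bgmSectorSet L M (klAnisoFamily L M β μ K klE0 J') 6).filter (fun σ'' : Fin 6 → SectorLeg (sectorCount J') => σ'' p = ℓ'' ∧ ∀ i, σ'' i ∈ O i) := by
    refine filter_congr fun σ'' _ => ?_
    simp only [hO, mem_filter, mem_univ, true_and]
  rw [hcongr]
  exact card_filter_le_of_fiveAnchored_of_mem _ klThinCount6C_pos.le (by positivity) h5 p ℓ'' O hOcard

/-! ## §3 The six-leg jump in the KL regime -/

/-- **THE SIX-LEG IMPORT BY JUMP RE-SECTORISATION, IN THE KL REGIME** (BGM 2006 (2.82)–(2.83) with the relative count (2.96)/(A3)): `∃ C₆ > 0` such that under the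
binders of `stub_engine_step_norms` (`P.WF`, `R.WF2`, `0 < c ≤ klEngC₃6 P R`, `μ ∈ klWindowC`, `0 < U ≤ klEngU₀9 P R c`, `klBetaMin ≤ β ≤ e^{c/U²}`, `FrameOK R U (nScales β) μ K`,
`klEngL₃ β U ≤ L`, `klEngM₃ β U L ≤ M`) and the six-count doors (`c ≤ klThinCount6C₃ R`, `U ≤ klThinCount6U₀ R`), for EVERY Grassmann polynomial `G` and every jump
`k + 1 ≤ J′ ≤ nScales β + 1`: the fine sectorised six-leg norm on the conservation-compatible tuples is at most `C₆·16^{J′−k}` times the coarse sectorised six-leg norm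
on all tuples — `‖G‖_{F_{J′}, bgmSectorSet} ≤ C₆·16^{J′−k}·‖G‖_{F_k, univ}`, `C₆ = (19683/64)·27⁴·C_J⁶·klThinCount6C` with `C_J` of `overlap_jump_sums_klEng`.
[cite: BenfattoGiulianiMastropietro2006, §2.8 (2.82)-(2.83), (2.96)-(2.98), App. A3] -/
theorem sixLeg_sectorNorm_jump_le_klEng :
    ∃ C₆ : ℝ, 0 < C₆ ∧ ∀ (P : SplitConsts) (R : RenConsts) (c : ℝ), P.WF → R.WF2 → 0 < c → c ≤ klEngC₃6 P R → c ≤ klThinCount6C₃ R →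
      ∀ μ ∈ klWindowC, ∀ U : ℝ, 0 < U → U ≤ klEngU₀9 P R c → U ≤ klThinCount6U₀ R → ∀ β : ℝ, klBetaMin ≤ β → β ≤ Real.exp (c / U ^ 2) →
      ∀ K : TrigPolyC4v, FrameOK R U (nScales β) μ K → ∀ (L M : ℕ) [NeZero L] [NeZero M],
      klEngL₃ β U ≤ L → klEngM₃ β U L ≤ M → ∀ (G : HubbardGrassmann L M) (k J' : ℕ), k + 1 ≤ J' → J' ≤ nScales β + 1 →
        hubbardSectorKernelNorm L M β (klAnisoFamily L M β μ K klE0 J') (bgmSectorSet L M (klAnisoFamily L M β μ K klE0 J') 6) G ≤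
          C₆ * (16 : ℝ) ^ (J' - k) *
            hubbardSectorKernelNorm L M β (klAnisoFamily L M β μ K klE0 k) (univ : Finset (Fin 6 → SectorLeg (sectorCount k))) G := by
  obtain ⟨CJ, hCJ, hov⟩ := overlap_jump_sums_klEng
  refine ⟨19683 / 64 * 27 ^ 4 * CJ ^ 6 * klThinCount6C, by have := klThinCount6C_pos; positivity, ?_⟩
  intro P R c hP hR2 hc hc6 hcT6 μ hμ U hU hU9 hUT6 β hβmin hβc K hK L M _ _ hL3 hM3 G k J' hJ hJN
  have hRj : ∀ j, 0 ≤ R.Gfr j := gfr_nonneg_of_wf2 hR2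
  have hβ0 : 0 < β := pos_of_klBetaMin_le hβmin
  have hM0 : (0 : ℝ) < M := Nat.cast_pos.2 (Nat.pos_of_ne_zero (NeZero.ne M))
  obtain ⟨hrow, hcol, -⟩ := hov P R c hP hR2 hc hc6 μ hμ U hU hU9 β hβmin hβc K hK L M hL3 hM3 k J' hJ hJN
  have hkJ : k ≤ J' := by omega
  -- the relative count
  have hRel := fun σ' p ℓ'' => relCount_six_jump_le_doors hRj hc hcT6 hU hUT6 hβmin hβc hμ μ hK L M hkJ σ' p ℓ''
  have hcr0 : (0 : ℝ) ≤ 81 * CJ * M / β := by positivity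
  have hc₁0 : (0 : ℝ) ≤ 3 * CJ * M / β := by positivity
  have hR0 : (0 : ℝ) ≤ klThinCount6C * (27 * (2 : ℝ) ^ (J' - k)) ^ 4 := by have := klThinCount6C_pos; positivity
  have hjump := hubbardSectorKernelNorm_klAniso_jump_le_of_relCount hβ0 μ K hJ G hcr0 hc₁0 hR0 hrow hcol 5
    (bgmSectorSet L M (klAnisoFamily L M β μ K klE0 J') 6) (fun σ' p ℓ'' => hRel σ' p ℓ'')
  refine hjump.trans (le_of_eq ?_)
  -- units: `cr·c₁⁵·ε⁵·ε = 81·3⁵·CJ⁶/2⁶`, `(27·2^Δ)⁴ = 27⁴·16^Δ`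
  have hε : imagTimeWeight β M = β / (2 * M) := rfl
  have h16 : ((2 : ℝ) ^ (J' - k)) ^ 4 = (16 : ℝ) ^ (J' - k) := by rw [← pow_mul, mul_comm, pow_mul]; norm_num
  have hβne : β ≠ 0 := hβ0.ne'
  have hMne : (M : ℝ) ≠ 0 := hM0.ne'
  rw [hε, ← h16]
  field_simp
  ring

/-! ## §4 KL vocabulary: conserving polynomials, the block inputs, and the law transport -/

omit [NeZero L] in
/-- For a MOMENTUM-CONSERVING polynomial the sectorised norm over ALL label tuples is the norm over the conservation-compatible ones (the sectorised kernels vanish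
off `bgmSectorSet`, `sectorisedKernel_eq_zero_of_not_mem_bgmSectorSet`). [cite: BenfattoGiulianiMastropietro2006, §2.8 (2.76)] -/
theorem hubbardSectorKernelNorm_univ_eq_bgmSectorSet_of_conserving [NeZero L] {N : ℕ} (β : ℝ) (F : Fin N → FreqMomentum L M → ℂ) (G : HubbardGrassmann L M)
    (hG : ∀ (m : ℕ) (X : Fin m → HubbardFieldIdx L M), ∑ i, signedMomentum L (X i).2 (X i).1.1.2 ≠ 0 → kernel ℂ G m X = 0) (m : ℕ) :
    hubbardSectorKernelNorm L M β F (univ : Finset (Fin m → SectorLeg N)) G = hubbardSectorKernelNorm L M β F (bgmSectorSet L M F m) G := by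
  rw [hubbardSectorKernelNorm_def, hubbardSectorKernelNorm_def]
  exact (sectorisedKernelNorm_eq_of_support (subset_univ _) fun Ω _ hΩ =>
    funext fun x => sectorisedKernel_eq_zero_of_not_mem_bgmSectorSet β F G hG hΩ x).symm

/-- **THE SIX-LEG LEVELLED NORMS OF A CONSERVING POLYNOMIAL TRANSPORT DOWN THE LEVELS** (KL vocabulary of §3): with `C₆` of `sixLeg_sectorNorm_jump_le_klEng`, under the
same binders, for every momentum-conserving `G`, every jump `k + 1 ≤ J′ ≤ nScales β + 1` and EVERY fine prescription `Ωe″`: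
`klLevNormOf L M β μ K J′ 6 G Ωe″ ≤ C₆·16^{J′−k}·klLevNormOf L M β μ K k 6 G (fun _ => none)`.
[cite: BenfattoGiulianiMastropietro2006, §2.8 (2.82)-(2.83), (2.96)-(2.98)] -/
theorem klLevNormOf_six_jump_le_klEng :
    ∃ C₆ : ℝ, 0 < C₆ ∧ ∀ (P : SplitConsts) (R : RenConsts) (c : ℝ), P.WF → R.WF2 → 0 < c → c ≤ klEngC₃6 P R → c ≤ klThinCount6C₃ R →
      ∀ μ ∈ klWindowC, ∀ U : ℝ, 0 < U → U ≤ klEngU₀9 P R c → U ≤ klThinCount6U₀ R → ∀ β : ℝ, klBetaMin ≤ β → β ≤ Real.exp (c / U ^ 2) →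
      ∀ K : TrigPolyC4v, FrameOK R U (nScales β) μ K → ∀ (L M : ℕ) [NeZero L] [NeZero M],
      klEngL₃ β U ≤ L → klEngM₃ β U L ≤ M → ∀ (G : HubbardGrassmann L M),
        (∀ (m : ℕ) (X : Fin m → HubbardFieldIdx L M), ∑ i, signedMomentum L (X i).2 (X i).1.1.2 ≠ 0 → kernel ℂ G m X = 0) →
        ∀ (k J' : ℕ), k + 1 ≤ J' → J' ≤ nScales β + 1 → ∀ Ωe'' : Fin 6 → Option (SectorLeg (sectorCount J')),
          klLevNormOf L M β μ K J' 6 G Ωe'' ≤ C₆ * (16 : ℝ) ^ (J' - k) * klLevNormOf L M β μ K k 6 G (fun _ => none) := by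
  obtain ⟨C₆, hC₆, h⟩ := sixLeg_sectorNorm_jump_le_klEng
  refine ⟨C₆, hC₆, ?_⟩
  intro P R c hP hR2 hc hc6 hcT6 μ hμ U hU hU9 hUT6 β hβmin hβc K hK L M _ _ hL3 hM3 G hG k J' hJ hJN Ωe''
  have hβ0 : 0 ≤ β := (pos_of_klBetaMin_le hβmin).le
  have hstep := h P R c hP hR2 hc hc6 hcT6 μ hμ U hU hU9 hUT6 β hβmin hβc K hK L M hL3 hM3 G k J' hJ hJN
  unfold klLevNormOf
  rw [prescribedTuples_none, ← hubbardSectorKernelNorm_univ_eq_bgmSectorSet_of_conserving β _ G hG 6]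
  refine le_trans ?_ hstep
  rw [hubbardSectorKernelNorm_def, hubbardSectorKernelNorm_def]
  exact sectorisedKernelNorm_mono_set (imagTimeWeight_nonneg hβ0 M) (prescribedTuples_subset _ _) _

/-- **THE BLOCK INPUT `𝒱_{dk′}[K]` READ AT ANY FINER LEVEL FROM ONE COARSER LEVEL** (instance `G = klTowerInput L M β U μ K d k′`, which conserves momentum): with `C₆` of
`sixLeg_sectorNorm_jump_le_klEng`, under the same binders, for every block `(d, k′)`, every jump `k + 1 ≤ J′ ≤ nScales β + 1` and every fine prescription:
`klLevNormOf … J′ 6 (klTowerInput … d k′) Ωe″ ≤ C₆·16^{J′−k}·klLevNormOf … k 6 (klTowerInput … d k′) (fun _ => none)`.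
[cite: BenfattoGiulianiMastropietro2006, §2.8 (2.82)-(2.83), (2.96)-(2.98)] -/
theorem klLevNormOf_six_klTowerInput_jump_le_klEng :
    ∃ C₆ : ℝ, 0 < C₆ ∧ ∀ (P : SplitConsts) (R : RenConsts) (c : ℝ), P.WF → R.WF2 → 0 < c → c ≤ klEngC₃6 P R → c ≤ klThinCount6C₃ R →
      ∀ μ ∈ klWindowC, ∀ U : ℝ, 0 < U → U ≤ klEngU₀9 P R c → U ≤ klThinCount6U₀ R → ∀ β : ℝ, klBetaMin ≤ β → β ≤ Real.exp (c / U ^ 2) →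
      ∀ K : TrigPolyC4v, FrameOK R U (nScales β) μ K → ∀ (L M : ℕ) [NeZero L] [NeZero M],
      klEngL₃ β U ≤ L → klEngM₃ β U L ≤ M → ∀ (d k' k J' : ℕ), k + 1 ≤ J' → J' ≤ nScales β + 1 →
        ∀ Ωe'' : Fin 6 → Option (SectorLeg (sectorCount J')),
          klLevNormOf L M β μ K J' 6 (klTowerInput L M β U μ K d k') Ωe'' ≤
            C₆ * (16 : ℝ) ^ (J' - k) * klLevNormOf L M β μ K k 6 (klTowerInput L M β U μ K d k') (fun _ => none) := by
  obtain ⟨C₆, hC₆, h⟩ := klLevNormOf_six_jump_le_klEng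
  refine ⟨C₆, hC₆, ?_⟩
  intro P R c hP hR2 hc hc6 hcT6 μ hμ U hU hU9 hUT6 β hβmin hβc K hK L M _ _ hL3 hM3 d k' k J' hJ hJN Ωe''
  exact h P R c hP hR2 hc hc6 hcT6 μ hμ U hU hU9 hUT6 β hβmin hβc K hK L M hL3 hM3 (klTowerInput L M β U μ K d k')
    (fun m X hX => by unfold klTowerInput; exact klEffectiveAction_momentumConserving β U μ K klE0 (d * k') m X hX) k J' hJ hJN Ωe''

/-- **THE DEGREE-SIX LAW ABSORBS THE JUMP FACTOR**: `CE³·ε_k²·2^{4k}·16^{J′−k} ≤ CE³·ε_{J′}²·2^{4J′}` for `k ≤ J′`, `0 ≤ CE` (`ε_k ≤ ε_{J′}`): re-sectorising a six-leg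
datum from level `k` to level `J′` is budget-neutral against `klWtBudget … 6 = CE³·ε_j²·2^{(3·3−5)j}`. [folklore] -/
theorem degreeSixLaw_mono_jump (P : SplitConsts) (hK : 0 ≤ P.Klam) {CE : ℝ} (hCE : 0 ≤ CE) (U : ℝ) {k J' : ℕ} (hkJ : k ≤ J') :
    CE ^ 3 * epsCoupling P U k ^ 2 * (2 : ℝ) ^ (4 * k) * (16 : ℝ) ^ (J' - k) ≤ CE ^ 3 * epsCoupling P U J' ^ 2 * (2 : ℝ) ^ (4 * J') := by
  have hε0 : 0 ≤ epsCoupling P U k := by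
    rw [epsCoupling]; exact mul_nonneg hK (by positivity)
  have hεle : epsCoupling P U k ≤ epsCoupling P U J' := by
    rw [epsCoupling, epsCoupling]
    refine mul_le_mul_of_nonneg_left ?_ hK
    have : (k : ℝ) ≤ J' := by exact_mod_cast hkJ
    nlinarith [sq_nonneg U, abs_nonneg U]
  have hpow : (2 : ℝ) ^ (4 * k) * (16 : ℝ) ^ (J' - k) = (2 : ℝ) ^ (4 * J') := by
    rw [show (16 : ℝ) = 2 ^ 4 by norm_num, ← pow_mul, ← pow_add]
    congr 1
    omega
  calc CE ^ 3 * epsCoupling P U k ^ 2 * (2 : ℝ) ^ (4 * k) * (16 : ℝ) ^ (J' - k)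
      = CE ^ 3 * epsCoupling P U k ^ 2 * ((2 : ℝ) ^ (4 * k) * (16 : ℝ) ^ (J' - k)) := by ring
    _ = CE ^ 3 * epsCoupling P U k ^ 2 * (2 : ℝ) ^ (4 * J') := by rw [hpow]
    _ ≤ CE ^ 3 * epsCoupling P U J' ^ 2 * (2 : ℝ) ^ (4 * J') := by gcongr

/-- **HEADLINE — THE SIX-LEG IMPORT NEEDS NO PLAIN LINE**: with `C₆` of `sixLeg_sectorNorm_jump_le_klEng`, under the binders of `stub_engine_step_norms` and the six-count
doors: if the block input `𝒱_{dk′}[K]` meets the degree-6 law UNPRESCRIBED at ONE level `k` (`klLevNormOf … k 6 (𝒱_{dk′}) (fun _ => none) ≤ Qe.CE³·ε_k²·2^{4k}` — the six-leg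
CELL in sectorised currency, BGM (2.77) `J^{(1)}` at `|P_{v₀}| = 6`), then at EVERY finer level `k + 1 ≤ J′ ≤ nScales β + 1` and every prescription it meets `C₆ ×` the
degree-6 law of level `J′`: `klLevNormOf … J′ 6 (𝒱_{dk′}) Ωe″ ≤ C₆·Qe.CE³·ε_{J′}²·2^{4J′}` (no gain claimed for prescribed legs). [cite: BenfattoGiulianiMastropietro2006, §2.8 (2.77), (2.82)-(2.83)] -/
theorem klLevNormOf_six_klTowerInput_le_law_of_coarse_law :
    ∃ C₆ : ℝ, 0 < C₆ ∧ ∀ (P : SplitConsts) (R : RenConsts) (c : ℝ), P.WF → R.WF2 → 0 < c → c ≤ klEngC₃6 P R → c ≤ klThinCount6C₃ R →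
      ∀ μ ∈ klWindowC, ∀ U : ℝ, 0 < U → U ≤ klEngU₀9 P R c → U ≤ klThinCount6U₀ R → ∀ β : ℝ, klBetaMin ≤ β → β ≤ Real.exp (c / U ^ 2) →
      ∀ K : TrigPolyC4v, FrameOK R U (nScales β) μ K → ∀ (L M : ℕ) [NeZero L] [NeZero M],
      klEngL₃ β U ≤ L → klEngM₃ β U L ≤ M → ∀ (Qe : EngConsts), 0 ≤ Qe.CE → ∀ (d k' k : ℕ),
        klLevNormOf L M β μ K k 6 (klTowerInput L M β U μ K d k') (fun _ => none) ≤ Qe.CE ^ 3 * epsCoupling P U k ^ 2 * (2 : ℝ) ^ (4 * k) →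
        ∀ J' : ℕ, k + 1 ≤ J' → J' ≤ nScales β + 1 → ∀ Ωe'' : Fin 6 → Option (SectorLeg (sectorCount J')),
          klLevNormOf L M β μ K J' 6 (klTowerInput L M β U μ K d k') Ωe'' ≤ C₆ * (Qe.CE ^ 3 * epsCoupling P U J' ^ 2 * (2 : ℝ) ^ (4 * J')) := by
  obtain ⟨C₆, hC₆, h⟩ := klLevNormOf_six_klTowerInput_jump_le_klEng
  refine ⟨C₆, hC₆, ?_⟩
  intro P R c hP hR2 hc hc6 hcT6 μ hμ U hU hU9 hUT6 β hβmin hβc K hK L M _ _ hL3 hM3 Qe hCE d k' k hcell J' hJ hJN Ωe''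
  have hjump := h P R c hP hR2 hc hc6 hcT6 μ hμ U hU hU9 hUT6 β hβmin hβc K hK L M hL3 hM3 d k' k J' hJ hJN Ωe''
  have hlaw := degreeSixLaw_mono_jump P (zero_le_one.trans hP.1) hCE U (show k ≤ J' by omega)
  have h16 : (0 : ℝ) ≤ (16 : ℝ) ^ (J' - k) := by positivity
  calc klLevNormOf L M β μ K J' 6 (klTowerInput L M β U μ K d k') Ωe''
      ≤ C₆ * (16 : ℝ) ^ (J' - k) * klLevNormOf L M β μ K k 6 (klTowerInput L M β U μ K d k') (fun _ => none) := hjump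
    _ ≤ C₆ * (16 : ℝ) ^ (J' - k) * (Qe.CE ^ 3 * epsCoupling P U k ^ 2 * (2 : ℝ) ^ (4 * k)) :=
        mul_le_mul_of_nonneg_left hcell (mul_nonneg hC₆.le h16)
    _ = C₆ * (Qe.CE ^ 3 * epsCoupling P U k ^ 2 * (2 : ℝ) ^ (4 * k) * (16 : ℝ) ^ (J' - k)) := by ring
    _ ≤ C₆ * (Qe.CE ^ 3 * epsCoupling P U J' ^ 2 * (2 : ℝ) ^ (4 * J')) := mul_le_mul_of_nonneg_left hlaw hC₆.le

end Summit.HubbardSuperconductivity.HubbardSuperconductivity.Theorems.EngineV8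

end
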